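import Mathlib
import Literature.AlgebraicGeometry.Resolution.PolygonInvariants
import HarnessLib

/-!
# The `u₁ ↔ u₂` symmetry of the characteristic polygon

Topic: `Literature/AlgebraicGeometry/Resolution`. Swapping the two boundary parameters
`u₁, u₂` of the regular system of parameters `c = (y, u₁, u₂)` reflects the characteristic
polygon `Δ(J; u₁, u₂; y)` in the diagonal: the Newton points, the weighted order ideals and the
initial unit terms of `WeightedInitialTerms` are equivariant under the transposition
`σ = (1 2)` of the indices, and the scaled invariants of `PolygonInvariants` are exchanged:
`δ ↔ δ`, `α ↔ ε`, `β ↔ ζ` (Cossart–Jannsen–Saito, LNM 2270, Definition 11.1 and the picture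
below it; Lemma 12.2 is Lemma 12.1 with `u₁, u₂` exchanged). This lets the laws at the origin of
the `u₂`-chart of a point blow-up (CJS Lemma 12.2: `α″ = α`, `β″ ≤ α + β − 1`) be READ OFF the
laws for `ε, ζ` at the origin of the `u₁`-chart (`PointBlowupPolygonLaws`). PROVED, no facts:

* `eswap`, `weight_comp_σ₁₂`, `monom3_comp_σ₁₂`, `weightedIdealW_comp_σ₁₂`;
* `isInitialTerm_comp_σ₁₂_iff`, `mem_occ_comp_σ₁₂_iff`, `mem_pts_comp_σ₁₂_iff`;
* `spt₁_eswap`, `spt₂_eswap`, `deltaS_comp_σ₁₂`, `alphaS_comp_σ₁₂` (`= epsS`),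
  `betaS_comp_σ₁₂` (`= zetaS`), `epsS_comp_σ₁₂` (`= alphaS`), `zetaS_comp_σ₁₂` (`= betaS`).

## Sources

* V. Cossart, U. Jannsen, S. Saito, LNM 2270 (2020), Def. 11.1, Lemmas 12.1–12.2.
  [CossartJannsenSaito2020]
* V. Cossart, O. Piltant, J. Algebra 320 (2008), proof of Lemma 4.5 (the two charts, p. 12).
  [CossartPiltant2008]
-/

noncomputable section

open IsLocalRing MvPolynomial

namespace Literature.AlgebraicGeometry.Resolution

universe u

variable {R : Type u} [CommRing R]

/-! ## The transposition and the exponent swap -/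

/-- The transposition `(1 2)` of `Fin 3` (exchange of `u₁` and `u₂`). [folklore] -/
def σ₁₂ : Equiv.Perm (Fin 3) := Equiv.swap 1 2

/-- Component / bookkeeping lemma. [folklore] -/
@[simp] theorem σ₁₂_zero : σ₁₂ 0 = 0 := by decide
/-- Component / bookkeeping lemma. [folklore] -/
@[simp] theorem σ₁₂_one : σ₁₂ 1 = 2 := by decide
/-- Component / bookkeeping lemma. [folklore] -/
@[simp] theorem σ₁₂_two : σ₁₂ 2 = 1 := by decide
/-- Component / bookkeeping lemma. [folklore] -/
@[simp] theorem σ₁₂_symm : σ₁₂.symm = σ₁₂ := Equiv.symm_swap 1 2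

/-- `σ₁₂` is an involution. [folklore] -/
@[simp] theorem σ₁₂_σ₁₂ (i : Fin 3) : σ₁₂ (σ₁₂ i) = i := Equiv.swap_apply_self _ _ _

/-- `(c ∘ σ) ∘ σ = c`. [folklore] -/
theorem comp_σ₁₂_comp_σ₁₂ {α : Type*} (c : Fin 3 → α) : (c ∘ σ₁₂) ∘ σ₁₂ = c := by
  funext i; simp

/-- The exponent swap `(e₀, e₁, e₂) ↦ (e₀, e₂, e₁)`. [folklore] -/
def eswap (e : Fin 3 →₀ ℕ) : Fin 3 →₀ ℕ := Finsupp.equivMapDomain σ₁₂ e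

/-- Component / bookkeeping lemma. [folklore] -/
@[simp] theorem eswap_apply (e : Fin 3 →₀ ℕ) (i : Fin 3) : eswap e i = e (σ₁₂ i) := by
  rw [eswap, Finsupp.equivMapDomain_apply, σ₁₂_symm]

/-- Component / bookkeeping lemma. [folklore] -/
theorem eswap_apply_zero (e : Fin 3 →₀ ℕ) : eswap e 0 = e 0 := by simp
/-- Component / bookkeeping lemma. [folklore] -/
theorem eswap_apply_one (e : Fin 3 →₀ ℕ) : eswap e 1 = e 2 := by simp
/-- Component / bookkeeping lemma. [folklore] -/
theorem eswap_apply_two (e : Fin 3 →₀ ℕ) : eswap e 2 = e 1 := by simp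

/-- `eswap` is an involution. [folklore] -/
@[simp] theorem eswap_eswap (e : Fin 3 →₀ ℕ) : eswap (eswap e) = e := by
  ext i; simp

/-- `eswap` is injective. [folklore] -/
theorem eswap_injective : Function.Injective eswap := fun e e' h => by
  rw [← eswap_eswap e, h, eswap_eswap]

/-- `eswap e = e.mapDomain σ`. [folklore] -/
theorem eswap_eq_mapDomain (e : Fin 3 →₀ ℕ) : eswap e = e.mapDomain σ₁₂ :=
  Finsupp.equivMapDomain_eq_mapDomain _ _

/-- Weights: `⟨w ∘ σ, e⟩ = ⟨w, eswap e⟩`. [folklore] -/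
theorem weight_comp_σ₁₂ (w : Fin 3 → ℕ) (e : Fin 3 →₀ ℕ) :
    Finsupp.weight (w ∘ σ₁₂) e = Finsupp.weight w (eswap e) := by
  rw [Finsupp.weight_apply, Finsupp.weight_apply, Finsupp.sum_fintype _ _ (by simp),
    Finsupp.sum_fintype _ _ (by simp)]
  simp only [Fin.sum_univ_three, Function.comp_apply, σ₁₂_zero, σ₁₂_one, σ₁₂_two, eswap_apply,
    smul_eq_mul]
  ring

/-- Monomials: `(c ∘ σ)^e = c^{eswap e}`. [folklore] -/
theorem monom3_comp_σ₁₂ (c : Fin 3 → R) (e : Fin 3 →₀ ℕ) :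
    monom3 (c ∘ σ₁₂) e = monom3 c (eswap e) := by
  simp only [monom3, Function.comp_apply, σ₁₂_zero, σ₁₂_one, σ₁₂_two, eswap_apply]
  ring

/-- **The weighted order ideals are symmetric**: `F^{(w∘σ)}_ρ(c ∘ σ) = F^{(w)}_ρ(c)`.
[cite: CossartJannsenSaito2020, Def. 11.1] -/
theorem weightedIdealW_comp_σ₁₂ (c : Fin 3 → R) (w : Fin 3 → ℕ) (ρ : ℕ) :
    weightedIdealW (c ∘ σ₁₂) (w ∘ σ₁₂) ρ = weightedIdealW c w ρ := by
  refine le_antisymm (Ideal.span_le.mpr ?_) (Ideal.span_le.mpr ?_)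
  · rintro _ ⟨e, he, rfl⟩
    rw [SetLike.mem_coe, monom3_comp_σ₁₂]
    refine monomial_mem_weightedIdealW c w ?_
    rwa [← weight_comp_σ₁₂]
  · rintro _ ⟨e, he, rfl⟩
    rw [SetLike.mem_coe]
    have : monom3 c e = monom3 (c ∘ σ₁₂) (eswap e) := by
      rw [monom3_comp_σ₁₂, eswap_eswap]
    rw [this]
    refine monomial_mem_weightedIdealW (c ∘ σ₁₂) (w ∘ σ₁₂) ?_
    rwa [weight_comp_σ₁₂, eswap_eswap]

/-- Renaming the variables by `σ`: evaluation. [folklore] -/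
theorem eval_rename_σ₁₂ (c : Fin 3 → R) (F : MvPolynomial (Fin 3) R) :
    eval c (rename σ₁₂ F) = eval (c ∘ σ₁₂) F := eval_rename _ _ _

/-- Renaming the variables by `σ`: coefficients. [folklore] -/
theorem coeff_rename_σ₁₂ (F : MvPolynomial (Fin 3) R) (e : Fin 3 →₀ ℕ) :
    (rename σ₁₂ F).coeff (eswap e) = F.coeff e := by
  rw [eswap_eq_mapDomain]; exact coeff_rename_mapDomain _ σ₁₂.injective _ _

/-- Renaming the variables by `σ`: weighted homogeneity. [folklore] -/
theorem isWeightedHomogeneous_rename_σ₁₂ {w : Fin 3 → ℕ} {n : ℕ} {F : MvPolynomial (Fin 3) R}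
    (hF : F.IsWeightedHomogeneous (w ∘ σ₁₂) n) : (rename σ₁₂ F).IsWeightedHomogeneous w n := by
  intro d hd
  obtain ⟨u, rfl, hu⟩ := coeff_rename_ne_zero _ _ _ hd
  rw [← eswap_eq_mapDomain, ← weight_comp_σ₁₂]
  exact hF hu

/-- **Initial unit terms are symmetric** (one direction). [cite: CossartJannsenSaito2020, Def. 8.2] -/
theorem IsInitialTerm.of_comp_σ₁₂ {c : Fin 3 → R} {w : Fin 3 → ℕ} {f : R} {e : Fin 3 →₀ ℕ}
    (h : IsInitialTerm (c ∘ σ₁₂) (w ∘ σ₁₂) f e) : IsInitialTerm c w f (eswap e) := by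
  obtain ⟨F, hF, hu, hrem⟩ := h
  refine ⟨rename σ₁₂ F, ?_, ?_, ?_⟩
  · rw [← weight_comp_σ₁₂]; exact isWeightedHomogeneous_rename_σ₁₂ hF
  · rwa [coeff_rename_σ₁₂]
  · rw [eval_rename_σ₁₂, ← weight_comp_σ₁₂, ← weightedIdealW_comp_σ₁₂ c w]
    exact hrem

/-- **Initial unit terms are symmetric**: `e` is a `(w∘σ)`-initial unit term of `f` for `c ∘ σ`
iff `eswap e` is a `w`-initial unit term of `f` for `c`. [cite: CossartJannsenSaito2020, Def. 8.2] -/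
theorem isInitialTerm_comp_σ₁₂_iff (c : Fin 3 → R) (w : Fin 3 → ℕ) (f : R) (e : Fin 3 →₀ ℕ) :
    IsInitialTerm (c ∘ σ₁₂) (w ∘ σ₁₂) f e ↔ IsInitialTerm c w f (eswap e) := by
  refine ⟨IsInitialTerm.of_comp_σ₁₂, fun h => ?_⟩
  have h' : IsInitialTerm ((c ∘ σ₁₂) ∘ σ₁₂) ((w ∘ σ₁₂) ∘ σ₁₂) f (eswap e) := by
    rwa [comp_σ₁₂_comp_σ₁₂, comp_σ₁₂_comp_σ₁₂]
  simpa using IsInitialTerm.of_comp_σ₁₂ h'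

/-- Positivity of weights is symmetric. [folklore] -/
theorem forall_pos_comp_σ₁₂_iff (w : Fin 3 → ℕ) : (∀ i, 0 < (w ∘ σ₁₂) i) ↔ ∀ i, 0 < w i := by
  constructor
  · intro h i; simpa using h (σ₁₂ i)
  · intro h i; exact h _

/-- **Newton points are symmetric**: `e ∈ occ (c ∘ σ) J ⟺ eswap e ∈ occ c J`.
[cite: CossartJannsenSaito2020, Def. 8.5 (4)] -/
theorem mem_occ_comp_σ₁₂_iff (c : Fin 3 → R) (J : Ideal R) (e : Fin 3 →₀ ℕ) :
    e ∈ occ (c ∘ σ₁₂) J ↔ eswap e ∈ occ c J := by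
  constructor
  · rintro ⟨f, hf, w, hw, he⟩
    refine ⟨f, hf, w ∘ σ₁₂, fun i => hw (σ₁₂ i), ?_⟩
    have : IsInitialTerm (c ∘ σ₁₂) ((w ∘ σ₁₂) ∘ σ₁₂) f e := by rwa [comp_σ₁₂_comp_σ₁₂]
    exact (isInitialTerm_comp_σ₁₂_iff c (w ∘ σ₁₂) f e).mp this
  · rintro ⟨f, hf, w, hw, he⟩
    refine ⟨f, hf, w ∘ σ₁₂, fun i => hw _, ?_⟩
    exact (isInitialTerm_comp_σ₁₂_iff c w f e).mpr he

/-- **`pts` is symmetric**: `e ∈ pts (c ∘ σ) J μ ⟺ eswap e ∈ pts c J μ`. [folklore] -/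
theorem mem_pts_comp_σ₁₂_iff (c : Fin 3 → R) (J : Ideal R) (μ : ℕ) (e : Fin 3 →₀ ℕ) :
    e ∈ pts (c ∘ σ₁₂) J μ ↔ eswap e ∈ pts c J μ := by
  change e ∈ occ (c ∘ σ₁₂) J ∧ e 0 < μ ↔ eswap e ∈ occ c J ∧ eswap e 0 < μ
  rw [mem_occ_comp_σ₁₂_iff, eswap_apply_zero]

/-! ## The scaled coordinates and invariants under the swap -/

/-- `sfac` is symmetric. [folklore] -/
@[simp] theorem sfac_eswap (μ : ℕ) (e : Fin 3 →₀ ℕ) : sfac μ (eswap e) = sfac μ e := by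
  rw [sfac, sfac, eswap_apply_zero]

/-- `spt₁ (eswap e) = spt₂ e`. [folklore] -/
@[simp] theorem spt₁_eswap (μ : ℕ) (e : Fin 3 →₀ ℕ) : spt₁ μ (eswap e) = spt₂ μ e := by
  rw [spt₁, spt₂, sfac_eswap, eswap_apply_one]

/-- `spt₂ (eswap e) = spt₁ e`. [folklore] -/
@[simp] theorem spt₂_eswap (μ : ℕ) (e : Fin 3 →₀ ℕ) : spt₂ μ (eswap e) = spt₁ μ e := by
  rw [spt₁, spt₂, sfac_eswap, eswap_apply_two]

/-- Images of `pts (c ∘ σ)` under a function of the scaled coordinates. [folklore] -/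
theorem image_pts_comp_σ₁₂ (c : Fin 3 → R) (J : Ideal R) (μ : ℕ) (g : ℕ → ℕ → ℕ) :
    (fun e => g (spt₁ μ e) (spt₂ μ e)) '' pts (c ∘ σ₁₂) J μ =
      (fun e => g (spt₂ μ e) (spt₁ μ e)) '' pts c J μ := by
  ext n
  constructor
  · rintro ⟨e, he, rfl⟩
    refine ⟨eswap e, (mem_pts_comp_σ₁₂_iff c J μ e).mp he, ?_⟩
    simp
  · rintro ⟨e, he, rfl⟩
    refine ⟨eswap e, (mem_pts_comp_σ₁₂_iff c J μ _).mpr (by rwa [eswap_eswap]), ?_⟩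
    simp

/-- Images of subsets of `pts (c ∘ σ)` cut out by a symmetric-in-swap condition. [folklore] -/
theorem image_pts_sep_comp_σ₁₂ (c : Fin 3 → R) (J : Ideal R) (μ : ℕ) (g : ℕ → ℕ → ℕ)
    (P : ℕ → ℕ → Prop) :
    (fun e => g (spt₁ μ e) (spt₂ μ e)) '' {e | e ∈ pts (c ∘ σ₁₂) J μ ∧ P (spt₁ μ e) (spt₂ μ e)} =
      (fun e => g (spt₂ μ e) (spt₁ μ e)) '' {e | e ∈ pts c J μ ∧ P (spt₂ μ e) (spt₁ μ e)} := by
  ext n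
  constructor
  · rintro ⟨e, ⟨he, hP⟩, rfl⟩
    refine ⟨eswap e, ⟨(mem_pts_comp_σ₁₂_iff c J μ e).mp he, by simpa using hP⟩, ?_⟩
    simp
  · rintro ⟨e, ⟨he, hP⟩, rfl⟩
    refine ⟨eswap e, ⟨(mem_pts_comp_σ₁₂_iff c J μ _).mpr (by rwa [eswap_eswap]),
      by simpa using hP⟩, ?_⟩
    simp

/-- `pts` non-emptiness is symmetric. [folklore] -/
theorem pts_comp_σ₁₂_nonempty_iff (c : Fin 3 → R) (J : Ideal R) (μ : ℕ) :
    (pts (c ∘ σ₁₂) J μ).Nonempty ↔ (pts c J μ).Nonempty := by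
  constructor
  · rintro ⟨e, he⟩; exact ⟨eswap e, (mem_pts_comp_σ₁₂_iff c J μ e).mp he⟩
  · rintro ⟨e, he⟩
    exact ⟨eswap e, (mem_pts_comp_σ₁₂_iff c J μ _).mpr (by rwa [eswap_eswap])⟩

/-- **`δ` is symmetric.** [cite: CossartJannsenSaito2020, Def. 11.1] -/
theorem deltaS_comp_σ₁₂ (c : Fin 3 → R) (J : Ideal R) (μ : ℕ) :
    deltaS (c ∘ σ₁₂) J μ = deltaS c J μ := by
  rw [deltaS, deltaS, image_pts_comp_σ₁₂ c J μ (fun a b => a + b)]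
  congr 1
  ext n
  simp only [Set.mem_image]
  constructor <;> rintro ⟨e, he, rfl⟩ <;> exact ⟨e, he, by ring⟩

/-- **`α(c ∘ σ) = ε(c)`.** [cite: CossartJannsenSaito2020, Def. 11.1] -/
theorem alphaS_comp_σ₁₂ (c : Fin 3 → R) (J : Ideal R) (μ : ℕ) :
    alphaS (c ∘ σ₁₂) J μ = epsS c J μ := by
  rw [alphaS, epsS]
  exact congrArg sInf (image_pts_comp_σ₁₂ c J μ (fun a _ => a))

/-- **`ε(c ∘ σ) = α(c)`.** [cite: CossartJannsenSaito2020, Def. 11.1] -/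
theorem epsS_comp_σ₁₂ (c : Fin 3 → R) (J : Ideal R) (μ : ℕ) :
    epsS (c ∘ σ₁₂) J μ = alphaS c J μ := by
  rw [alphaS, epsS]
  exact congrArg sInf (image_pts_comp_σ₁₂ c J μ (fun _ b => b))

/-- **`β(c ∘ σ) = ζ(c)`.** [cite: CossartJannsenSaito2020, Def. 11.1] -/
theorem betaS_comp_σ₁₂ (c : Fin 3 → R) (J : Ideal R) (μ : ℕ) :
    betaS (c ∘ σ₁₂) J μ = zetaS c J μ := by
  rw [betaS, zetaS, alphaS_comp_σ₁₂]
  exact congrArg sInf (image_pts_sep_comp_σ₁₂ c J μ (fun _ b => b) (fun a _ => a = epsS c J μ))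

/-- **`ζ(c ∘ σ) = β(c)`.** [cite: CossartJannsenSaito2020, Def. 11.1] -/
theorem zetaS_comp_σ₁₂ (c : Fin 3 → R) (J : Ideal R) (μ : ℕ) :
    zetaS (c ∘ σ₁₂) J μ = betaS c J μ := by
  rw [betaS, zetaS, epsS_comp_σ₁₂]
  exact congrArg sInf (image_pts_sep_comp_σ₁₂ c J μ (fun a _ => a) (fun _ b => b = alphaS c J μ))

/-- Maximal ideal generation is symmetric. [folklore] -/
theorem span_triple_comp_σ₁₂ (c : Fin 3 → R) :
    Ideal.span {(c ∘ σ₁₂) 0, (c ∘ σ₁₂) 1, (c ∘ σ₁₂) 2} = Ideal.span {c 0, c 1, c 2} := by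
  simp only [Function.comp_apply, σ₁₂_zero, σ₁₂_one, σ₁₂_two]
  congr 1
  ext x
  simp only [Set.mem_insert_iff, Set.mem_singleton_iff]
  tauto

end Literature.AlgebraicGeometry.Resolution
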